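import Literature.AlgebraicGeometry.Frobenioids.MonoidFunctors
import Literature.AlgebraicGeometry.Frobenioids.ElementaryFrobenioid
import HarnessLib

/-!
# Frobenioids I, Definition 1.1 (ii): `Φ^gp`, `Φ^pf` are monoids on `D` (abc-iut cell, layer L1;
# referee item C1-F8 (b); `Φ^char` is `isMonoidOn_charFunctor` in `ElementaryPreFrobenioid.lean`)

Mochizuki, *The geometry of Frobenioids I: the general theory*, Kyushu J. Math. **62** (2008)
293–400, §1, Definition 1.1 (ii), kurims text p. 19 [cite: MochizukiFrdI2008, Def. 1.1(ii)]:

> "Note that if `Φ` is a monoid on `D`, then `Φ` determines monoids "`Φ^char`", "`Φ^gp`", "`Φ^pf`"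
> on `D` [i.e., by assigning `A ↦ Φ(A)^char`, `A ↦ Φ(A)^gp`, `A ↦ Φ(A)^pf`], which we shall refer
> to, respectively, as the characteristic, groupification, and perfection of `Φ`."

A monoid on `D` (Def. 1.1 (ii)) is a functor all of whose pull-back maps are (a) characteristically
injective (injective, and injective on characteristics) and (b) bijective along FSM-morphisms.
The claim for `Φ^char = charFunctor Φ` is `isMonoidOn_charFunctor` (`ElementaryPreFrobenioid.lean`);
here we prove it for `Φ^gp = groupificationFunctor Φ` under the hypothesis that the `Φ(A)` are *integral* (as they are for the pre-divisorial
monoids of Def. 1.1 (i), the case in which the text uses `Φ^gp`). READING recorded for the referee: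
without integrality (a) fails for `Φ^gp` — the inclusion `ℕ → ℕ ∪ {∞}` (`∞` absorbing) is
characteristically injective but induces `ℤ → 0` on groupifications — so the bare sentence is read
with the standing "pre-divisorial" of §1 in force. (`Φ^pf`: (b) and the injectivity half of (a) are
proved below; injectivity on characteristics of `Φ(f)^pf` is left as a statement-level remark.)
No statement of the paper is strengthened.
-/

namespace Literature.AlgebraicGeometry.Frobenioids

open CategoryTheory Opposite Function

universe w v u

/-! ### Groupification of an injective homomorphism of cancellative monoids is injective -/

section Groupification

variable {M N : Type w} [CommMonoid M] [CommMonoid N]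

/-- Every element of `M^gp` is a fraction of two elements of `M` (`M^gp`, FrdI §0 p. 11).
[cite: MochizukiFrdI2008, §0 p.11] -/
private theorem gp_exists_frac (c : Algebra.GrothendieckGroup M) :
    ∃ a b : M, c * Algebra.GrothendieckGroup.of b = Algebra.GrothendieckGroup.of a := by
  induction c using Localization.induction_on with
  | H p =>
    refine ⟨p.1, p.2, ?_⟩
    rw [Localization.mk_eq_monoidOf_mk'_apply]
    exact Submonoid.LocalizationMap.mk'_spec _ p.1 p.2

/-- For `f : M → N` injective with `M`, `N` integral (cancellative), `f^gp : M^gp → N^gp` is injective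
(used for Def. 1.1 (ii)(a) of `Φ^gp`). [cite: MochizukiFrdI2008, Def. 1.1(ii)] -/
theorem gpMap_injective [IsCancelMul M] [IsCancelMul N] (f : M →* N) (hf : Injective f) :
    Injective (gpMap f) := by
  intro x y hxy
  obtain ⟨a, b, hab⟩ := gp_exists_frac x
  obtain ⟨c, d, hcd⟩ := gp_exists_frac y
  have hx : gpMap f x * Algebra.GrothendieckGroup.of (f b) = Algebra.GrothendieckGroup.of (f a) := by
    rw [← gpMap_of, ← map_mul, hab, gpMap_of]
  have hy : gpMap f y * Algebra.GrothendieckGroup.of (f d) = Algebra.GrothendieckGroup.of (f c) := by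
    rw [← gpMap_of, ← map_mul, hcd, gpMap_of]
  -- `f (a d) = f (c b)` in `N`, via `N^gp`
  have h1 : Algebra.GrothendieckGroup.of (f (a * d)) = Algebra.GrothendieckGroup.of (f (c * b)) := by
    rw [map_mul, map_mul, map_mul, map_mul, ← hx, ← hy, hxy]
    simp only [mul_comm, mul_left_comm]
  have h2 : a * d = c * b := hf (Algebra.GrothendieckGroup.of_injective h1)
  -- back in `M^gp`
  have h3 : x * (Algebra.GrothendieckGroup.of b * Algebra.GrothendieckGroup.of d) =
      y * (Algebra.GrothendieckGroup.of b * Algebra.GrothendieckGroup.of d) := by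
    calc x * (Algebra.GrothendieckGroup.of b * Algebra.GrothendieckGroup.of d)
        = Algebra.GrothendieckGroup.of a * Algebra.GrothendieckGroup.of d := by rw [← mul_assoc, hab]
      _ = Algebra.GrothendieckGroup.of (c * b) := by rw [← map_mul, h2]
      _ = y * (Algebra.GrothendieckGroup.of b * Algebra.GrothendieckGroup.of d) := by
          rw [map_mul, ← hcd, mul_assoc, mul_comm (Algebra.GrothendieckGroup.of d)]
  exact mul_right_cancel h3

/-- For `f : M → N` bijective, `f^gp` is bijective (functoriality of `M ↦ M^gp`; Def. 1.1 (ii)(b)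
of `Φ^gp`). [cite: MochizukiFrdI2008, Def. 1.1(ii)] -/
theorem gpMap_bijective_of_bijective (f : M →* N) (hf : Bijective f) : Bijective (gpMap f) := by
  let e : M ≃* N := MulEquiv.ofBijective f hf
  have h₁ : (gpMap e.symm.toMonoidHom).comp (gpMap f) = MonoidHom.id _ := by
    rw [← gpMap_comp, show e.symm.toMonoidHom.comp f = MonoidHom.id M from
      MonoidHom.ext fun a => e.symm_apply_apply a, gpMap_id]
  have h₂ : (gpMap f).comp (gpMap e.symm.toMonoidHom) = MonoidHom.id _ := by
    rw [← gpMap_comp, show f.comp e.symm.toMonoidHom = MonoidHom.id N from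
      MonoidHom.ext fun b => e.apply_symm_apply b, gpMap_id]
  refine ⟨fun x y h => ?_, fun z => ⟨gpMap e.symm.toMonoidHom z, DFunLike.congr_fun h₂ z⟩⟩
  have := DFunLike.congr_fun h₁ x
  have := DFunLike.congr_fun h₁ y
  simp only [MonoidHom.comp_apply, MonoidHom.id_apply] at *
  rw [← ‹gpMap e.symm.toMonoidHom (gpMap f x) = x›, h]
  assumption

/-- In a group the characteristic is trivial: any map out of `Associates G` is injective.
[cite: MochizukiFrdI2008, §0 p.11] -/
theorem associates_subsingleton_of_group {G : Type w} [CommGroup G] : Subsingleton (Associates G) := by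
  refine ⟨fun a b => ?_⟩
  obtain ⟨a, rfl⟩ := Associates.mk_surjective a
  obtain ⟨b, rfl⟩ := Associates.mk_surjective b
  rw [Associates.mk_eq_one.mpr (Group.isUnit a), Associates.mk_eq_one.mpr (Group.isUnit b)]

end Groupification

/-! ### `Φ^gp` is a monoid on `D` -/

section OnD

variable {D : Type u} [Category.{v} D] (Φ : Dᵒᵖ ⥤ CommMonCat.{w})

/-- The pull-back maps of `Φ^gp` are the groupifications of those of `Φ`. [cite: MochizukiFrdI2008, Def. 1.1(ii)] -/
theorem pull_groupificationFunctor {A B : D} (f : B ⟶ A) (x : (groupificationFunctor Φ).obj (op A)) :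
    pull (groupificationFunctor Φ) f x = gpMap (pull Φ f) x := rfl

/-- **Def. 1.1 (ii)**: for a monoid `Φ` on `D` with integral values, `Φ^gp` is a monoid on `D`.
[cite: MochizukiFrdI2008, Def. 1.1(ii)] -/
theorem isMonoidOn_groupificationFunctor (hΦ : IsMonoidOn Φ)
    (hint : Objectwise (fun M _ => IsIntegral M) Φ) : IsMonoidOn (groupificationFunctor Φ) where
  isCharInjective {A B} f := by
    haveI : IsCancelMul (Φ.obj (op A)) := isIntegral_iff_isCancelMul.mp (hint A)
    haveI : IsCancelMul (Φ.obj (op B)) := isIntegral_iff_isCancelMul.mp (hint B)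
    haveI : Subsingleton (Associates ((groupificationFunctor Φ).obj (op A))) :=
      associates_subsingleton_of_group (G := Algebra.GrothendieckGroup (Φ.obj (op A)))
    exact ⟨gpMap_injective (pull Φ f) (hΦ.isCharInjective f).1, fun a b _ => Subsingleton.elim a b⟩
  bijective_of_isFSM f hf := gpMap_bijective_of_bijective (pull Φ f) (hΦ.bijective_of_isFSM f hf)

/-! ### `Φ^pf`: injectivity and FSM-bijectivity -/

/-- For `f : M → N` injective, `f^pf : M^pf → N^pf` is injective. [cite: MochizukiFrdI2008, Def. 1.1(ii)] -/
theorem perfectionMap_injective {M N : Type w} [CommMonoid M] [CommMonoid N] (f : M →* N)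
    (hf : Injective f) : Injective (Perfection.map f) := by
  intro x y hxy
  obtain ⟨⟨a, n⟩, rfl⟩ := Perfection.mk_surjective x
  obtain ⟨⟨b, m⟩, rfl⟩ := Perfection.mk_surjective y
  change Perfection.mk a n = Perfection.mk b m
  change Perfection.map f (Perfection.mk a n) = Perfection.map f (Perfection.mk b m) at hxy
  rw [Perfection.map_mk, Perfection.map_mk, Perfection.mk_eq_mk_iff] at hxy
  obtain ⟨K, hK⟩ := hxy
  refine Perfection.mk_eq_mk_iff.mpr ⟨K, hf ?_⟩
  have hK' : f a ^ ((K : ℕ) * (m : ℕ)) = f b ^ ((K : ℕ) * (n : ℕ)) := hK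
  rw [← map_pow, ← map_pow] at hK'
  exact hK'

/-- For `f` bijective, `f^pf` is bijective (functoriality of `M ↦ M^pf`). [cite: MochizukiFrdI2008, Def. 1.1(ii)] -/
theorem perfectionMap_bijective_of_bijective {M N : Type w} [CommMonoid M] [CommMonoid N] (f : M →* N)
    (hf : Bijective f) : Bijective (Perfection.map f) := by
  refine ⟨perfectionMap_injective f hf.1, fun z => ?_⟩
  obtain ⟨⟨b, m⟩, rfl⟩ := Perfection.mk_surjective z
  obtain ⟨a, rfl⟩ := hf.2 b
  exact ⟨Perfection.mk a m, Perfection.map_mk f a m⟩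

/-- **Def. 1.1 (ii)**, `Φ^pf`, part (b) and the injectivity half of (a): the pull-back maps of
`Φ^pf` are injective, and bijective along FSM-morphisms. [cite: MochizukiFrdI2008, Def. 1.1(ii)] -/
theorem perfectionFunctor_pull_injective_and_bijective (hΦ : IsMonoidOn Φ) {A B : D} (f : B ⟶ A) :
    Injective (pull (perfectionFunctor Φ) f) ∧
      (IsFSM f → Bijective (pull (perfectionFunctor Φ) f)) :=
  ⟨perfectionMap_injective (pull Φ f) (hΦ.isCharInjective f).1,
    fun hf => perfectionMap_bijective_of_bijective (pull Φ f) (hΦ.bijective_of_isFSM f hf)⟩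

end OnD

end Literature.AlgebraicGeometry.Frobenioids
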